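import Mathlib.Analysis.InnerProductSpace.Calculus
import Mathlib.MeasureTheory.Integral.IntervalIntegral.FundThmCalculus
import Literature.Analysis.FluidPDE.CurlFreeLiouville
import Literature.Analysis.FluidPDE.NSBoundedSpatialHolder
import Literature.Analysis.FunctionSpaces.SmoothParametricIntegral
import HarnessLib

/-!
# Potentials for fields with vanishing vertical vorticity: `V = ∇φ + ψ e₂`, `curl V = ∇ψ × e₂`

Analysis/FluidPDE support file (theorems only; no definitions, no named facts). Serves the
STAGED door route `PoloidalWindowDoor` of `NavierStokesRegularity` (cell ns-regularity-ideate,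
crux K2 `PoloidalWindowRigidity`: Type-I ancient mild profiles whose vorticity has one vanishing
Cartesian component, "poloidal" profiles), whose analysis is carried out in the CLEBSCH-type
variables `(φ, ψ)` below; the calculus is classical and independent of the Navier–Stokes equations.

Let `V : ℝ³ → ℝ³` be smooth with vanishing vertical vorticity, `(curl V)₂ ≡ 0`, i.e.
`∂₀V₁ = ∂₁V₀` (coordinates `0, 1, 2`; `e₂` is the vertical direction). Then on every horizontal
plane the horizontal part `V_h = (V₀, V₁)` is a gradient; the **horizontal line potential**

  `φ(x) = ∫₀¹ ⟪V(σ x_h + x₂ e₂), x_h⟫ dσ`,  `x_h = x − x₂ e₂`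

(the radial homotopy of the planar Poincaré lemma, with the height `x₂` as a parameter) is a
jointly smooth choice, normalised by `φ = 0` on the vertical axis. We prove:

* `VerticalVorticityFree.contDiff_linePotential` — `φ` is `C^∞` (differentiation under the
  integral sign, `Literature.Analysis.FunctionSpaces.contDiff_parametric_intervalIntegral`);
* `VerticalVorticityFree.fderiv_linePotential_single` — **`∂₀φ = V₀`, `∂₁φ = V₁`**: the
  `x`-derivative of the integrand in a horizontal direction `eᵢ` is
  `Vᵢ(σx_h + x₂e₂) + σ⟪DV(σx_h + x₂e₂)eᵢ, x_h⟫ = d/dσ [σ Vᵢ(σ x_h + x₂ e₂)]` by the symmetry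
  `∂₀V₁ = ∂₁V₀` (`inner_apply_single_horiz`), and the fundamental theorem of calculus;
* with the **stream function** `ψ := V₂ − ∂₂φ`:
  `VerticalVorticityFree.curl_apply_eq_fderiv_stream` — `(curl V)₀ = ∂₁ψ`, `(curl V)₁ = −∂₀ψ`,
  `(curl V)₂ = 0`, i.e. **`curl V = ∇ψ × e₂`** (the vortex lines are the level curves of `ψ` in
  the horizontal planes), and
  `VerticalVorticityFree.divergence_eq_laplacian_add_fderiv_stream` — **`div V = Δφ + ∂₂ψ`**
  (so `Δφ + ∂₂ψ = 0` for solenoidal `V`);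
* `VerticalVorticityFree.exists_potential_add_vertical` — the packaged statement
  **`V = ∇φ + ψ e₂`**, `curl V = cross (∇ψ) e₂`, `div V = Δφ + ∂₂ψ`, `φ|_{axis} = 0`, with
  `φ, ψ ∈ C^∞`.

In the language of the poloidal–toroidal decomposition with respect to `e₂`
(`V = ∇×(T e₂) + ∇×∇×(P e₂)` for solenoidal fields; Chandrasekhar 1961, App. III; Backus 1986),
`(curl V)₂ ≡ 0` says that the toroidal scalar is absent: `V = ∇(∂₂P) − (ΔP) e₂`, i.e. `φ = ∂₂P`,
`ψ = −ΔP`; this file does not introduce `P`.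

## Mathlib / tree search

Mathlib (this pin): convex Poincaré lemma for closed `1`-forms
`Convex.exists_forall_hasFDerivAt_of_fderiv_symmetric` (no parameter-dependent version; the
horizontal `1`-form `V₀dx₀ + V₁dx₁` is not closed in `ℝ³`), one derivative under the integral
sign (`intervalIntegral.hasFDerivAt_integral_of_dominated_of_fderiv_le`). Tree: smooth parametric
integrals `Literature.Analysis.FunctionSpaces.contDiff_parametric_intervalIntegral` /
`fderiv_parametric_intervalIntegral_apply` / `hasFDerivAt_comp_prodMk`
(`FunctionSpaces/SmoothParametricIntegral.lean`, used); the cone vector potential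
`conePotential` with `curl (conePotential f) = f` (`PoincareHomotopyOperator.lean`, the `2`-form
analogue); `ExteriorDeRham.exists_primitive_exterior`, `Sverak2011.exists_primitive_compl_zero`
(`1`-forms on non-convex domains); `curlCLM_apply`, `trace_eq_sum_coord` (`VorticityStretching`),
`laplacian_eq_sum_fderiv_fderiv` (`WholeSpaceIBP`), `fderiv_fderiv_apply_coord`
(`CurlFreeLiouville`), `SerrinBoundedHolder.fderiv_fderiv_apply_comm` (`NSBoundedSpatialHolder`,
symmetry of second derivatives in applied form, reused). Nothing for horizontal potentials / stream functions of non-axisymmetric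
fields with `ω₂ ≡ 0` (searched `streamFunction`, `Poincare`, `potential` + `curl`, 2026-08-26;
the axisymmetric files `AxisymPoloidalPart`, `Wei2016PoloidalCurl` treat the swirl-free
axisymmetric case only).

## References

* S. Chandrasekhar, *Hydrodynamic and Hydromagnetic Stability*, Oxford (1961), Appendix III
  (poloidal and toroidal fields).
* G. Backus, *Poloidal and toroidal fields in geomagnetic field modeling*, Rev. Geophys. 24
  (1986) 75–109, §2.
* A. Majda, A. Bertozzi, *Vorticity and Incompressible Flow*, CUP (2002), §1.1 (vector
  identities), §2.3 (two-and-a-half-dimensional flows).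
* M. Spivak, *Calculus on Manifolds* (1965), Thm. 4-11 (Poincaré lemma by radial homotopy).
-/

noncomputable section

open Set Function MeasureTheory intervalIntegral InnerProductSpace
open scoped Laplacian InnerProductSpace RealInnerProductSpace ContDiff

namespace Literature.Analysis.FluidPDE

namespace VerticalVorticityFree

/-! ### Coordinates: the horizontal part `x − x₂ e₂` and the horizontal rays -/

/-- `x − x₂ e₂ = x₀ e₀ + x₁ e₁` (the horizontal part of `x`). [folklore] -/
private theorem sub_smul_single_two_eq (x : (EuclideanSpace ℝ (Fin 3))) :
    x - x 2 • (EuclideanSpace.single (2 : Fin 3) (1 : ℝ)) = x 0 • (EuclideanSpace.single (0 : Fin 3) (1 : ℝ)) + x 1 • (EuclideanSpace.single (1 : Fin 3) (1 : ℝ)) := by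
  ext i
  fin_cases i <;> simp

/-- The coordinate `x ↦ x₂` is smooth (it is the continuous linear form `e₂*`). [folklore] -/
private theorem contDiff_apply_two : ContDiff ℝ ∞ fun x : (EuclideanSpace ℝ (Fin 3)) => x 2 :=
  (EuclideanSpace.proj (2 : Fin 3) : (EuclideanSpace ℝ (Fin 3)) →L[ℝ] ℝ).contDiff

/-- The integrand of the horizontal line potential, `(σ, x) ↦ ⟪V(σ x_h + x₂ e₂), x_h⟫`
(`x_h = x − x₂ e₂`), is smooth for smooth `V`. [folklore] -/
private theorem contDiff_lineIntegrand {V : (EuclideanSpace ℝ (Fin 3)) → (EuclideanSpace ℝ (Fin 3))} (hV : ContDiff ℝ ∞ V) :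
    ContDiff ℝ ∞ fun q : ℝ × (EuclideanSpace ℝ (Fin 3)) =>
      ⟪V (q.1 • (q.2 - q.2 2 • (EuclideanSpace.single (2 : Fin 3) (1 : ℝ))) + q.2 2 • (EuclideanSpace.single (2 : Fin 3) (1 : ℝ))), q.2 - q.2 2 • (EuclideanSpace.single (2 : Fin 3) (1 : ℝ))⟫_ℝ := by
  have h2 : ContDiff ℝ ∞ fun q : ℝ × (EuclideanSpace ℝ (Fin 3)) => q.2 2 := contDiff_apply_two.comp contDiff_snd
  have hB : ContDiff ℝ ∞ fun q : ℝ × (EuclideanSpace ℝ (Fin 3)) => q.2 - q.2 2 • (EuclideanSpace.single (2 : Fin 3) (1 : ℝ)) :=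
    contDiff_snd.sub (h2.smul contDiff_const)
  have hA : ContDiff ℝ ∞ fun q : ℝ × (EuclideanSpace ℝ (Fin 3)) => q.1 • (q.2 - q.2 2 • (EuclideanSpace.single (2 : Fin 3) (1 : ℝ))) + q.2 2 • (EuclideanSpace.single (2 : Fin 3) (1 : ℝ)) :=
    (contDiff_fst.smul hB).add (h2.smul contDiff_const)
  exact (hV.comp hA).inner ℝ hB

/-- **Smoothness of the horizontal line potential** `φ(x) = ∫₀¹ ⟪V(σ x_h + x₂ e₂), x_h⟫ dσ` of a
smooth field (differentiation under the integral sign,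
`Literature.Analysis.FunctionSpaces.contDiff_parametric_intervalIntegral`). [cite: Spivak1965, Thm 4-11 (Poincaré Lemma; the operator I on 1-forms)] -/
theorem contDiff_linePotential {V : (EuclideanSpace ℝ (Fin 3)) → (EuclideanSpace ℝ (Fin 3))} (hV : ContDiff ℝ ∞ V) :
    ContDiff ℝ ∞ fun x : (EuclideanSpace ℝ (Fin 3)) =>
      ∫ σ in (0 : ℝ)..1, ⟪V (σ • (x - x 2 • (EuclideanSpace.single (2 : Fin 3) (1 : ℝ))) + x 2 • (EuclideanSpace.single (2 : Fin 3) (1 : ℝ))), x - x 2 • (EuclideanSpace.single (2 : Fin 3) (1 : ℝ))⟫_ℝ :=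
  Literature.Analysis.FunctionSpaces.contDiff_parametric_intervalIntegral
    (contDiff_lineIntegrand hV) 0 1

/-- Differentiation under the integral sign for the line potential: its derivative in the
direction `w` is the integral of the `x`-derivative of the integrand. [folklore] -/
private theorem fderiv_linePotential_apply {V : (EuclideanSpace ℝ (Fin 3)) → (EuclideanSpace ℝ (Fin 3))} (hV : ContDiff ℝ ∞ V) (x w : (EuclideanSpace ℝ (Fin 3))) :
    fderiv ℝ (fun x : (EuclideanSpace ℝ (Fin 3)) =>
      ∫ σ in (0 : ℝ)..1, ⟪V (σ • (x - x 2 • (EuclideanSpace.single (2 : Fin 3) (1 : ℝ))) + x 2 • (EuclideanSpace.single (2 : Fin 3) (1 : ℝ))), x - x 2 • (EuclideanSpace.single (2 : Fin 3) (1 : ℝ))⟫_ℝ) x w =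
      ∫ σ in (0 : ℝ)..1, fderiv ℝ (fun y : (EuclideanSpace ℝ (Fin 3)) =>
        ⟪V (σ • (y - y 2 • (EuclideanSpace.single (2 : Fin 3) (1 : ℝ))) + y 2 • (EuclideanSpace.single (2 : Fin 3) (1 : ℝ))), y - y 2 • (EuclideanSpace.single (2 : Fin 3) (1 : ℝ))⟫_ℝ) x w := by
  have hH := contDiff_lineIntegrand hV
  have hinf : (∞ : WithTop ℕ∞) ≠ 0 := by exact_mod_cast WithTop.coe_ne_zero.2 (by decide)
  rw [Literature.Analysis.FunctionSpaces.fderiv_parametric_intervalIntegral_apply hH hinf 0 1 x w]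
  refine intervalIntegral.integral_congr fun σ _ => ?_
  have hslice := (Literature.Analysis.FunctionSpaces.hasFDerivAt_comp_prodMk hH hinf σ x).fderiv
  simp only at hslice
  rw [hslice, ContinuousLinearMap.comp_apply, ContinuousLinearMap.inr_apply]


/-! ### The slice derivative of the integrand -/

/-- The `x`-derivative of the integrand `y ↦ ⟪V(σ y_h + y₂ e₂), y_h⟫` at `x` in the direction `w`:
`⟪V(σ x_h + x₂ e₂), w_h⟫ + ⟪DV(σ x_h + x₂ e₂)(σ w_h + w₂ e₂), x_h⟫` (chain and product rules). [folklore] -/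
private theorem fderiv_lineIntegrand_slice {V : (EuclideanSpace ℝ (Fin 3)) → (EuclideanSpace ℝ (Fin 3))} (hV : ContDiff ℝ ∞ V) (σ : ℝ) (x w : (EuclideanSpace ℝ (Fin 3))) :
    fderiv ℝ (fun y : (EuclideanSpace ℝ (Fin 3)) =>
        ⟪V (σ • (y - y 2 • (EuclideanSpace.single (2 : Fin 3) (1 : ℝ))) + y 2 • (EuclideanSpace.single (2 : Fin 3) (1 : ℝ))), y - y 2 • (EuclideanSpace.single (2 : Fin 3) (1 : ℝ))⟫_ℝ) x w =
      ⟪V (σ • (x - x 2 • (EuclideanSpace.single (2 : Fin 3) (1 : ℝ))) + x 2 • (EuclideanSpace.single (2 : Fin 3) (1 : ℝ))), w - w 2 • (EuclideanSpace.single (2 : Fin 3) (1 : ℝ))⟫_ℝ +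
        ⟪fderiv ℝ V (σ • (x - x 2 • (EuclideanSpace.single (2 : Fin 3) (1 : ℝ))) + x 2 • (EuclideanSpace.single (2 : Fin 3) (1 : ℝ))) (σ • (w - w 2 • (EuclideanSpace.single (2 : Fin 3) (1 : ℝ))) + w 2 • (EuclideanSpace.single (2 : Fin 3) (1 : ℝ))),
          x - x 2 • (EuclideanSpace.single (2 : Fin 3) (1 : ℝ))⟫_ℝ := by
  set L : (EuclideanSpace ℝ (Fin 3)) →L[ℝ] (EuclideanSpace ℝ (Fin 3)) := ContinuousLinearMap.id ℝ (EuclideanSpace ℝ (Fin 3)) -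
    (EuclideanSpace.proj (2 : Fin 3) : (EuclideanSpace ℝ (Fin 3)) →L[ℝ] ℝ).smulRight (EuclideanSpace.single (2 : Fin 3) (1 : ℝ)) with hL
  set M : (EuclideanSpace ℝ (Fin 3)) →L[ℝ] (EuclideanSpace ℝ (Fin 3)) := σ • L +
    (EuclideanSpace.proj (2 : Fin 3) : (EuclideanSpace ℝ (Fin 3)) →L[ℝ] ℝ).smulRight (EuclideanSpace.single (2 : Fin 3) (1 : ℝ)) with hM
  have hLx : ∀ y : (EuclideanSpace ℝ (Fin 3)), L y = y - y 2 • (EuclideanSpace.single (2 : Fin 3) (1 : ℝ)) := fun y => by simp [hL]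
  have hMx : ∀ y : (EuclideanSpace ℝ (Fin 3)), M y = σ • (y - y 2 • (EuclideanSpace.single (2 : Fin 3) (1 : ℝ))) + y 2 • (EuclideanSpace.single (2 : Fin 3) (1 : ℝ)) := fun y => by simp [hM, hL]
  have hfun : (fun y : (EuclideanSpace ℝ (Fin 3)) => V (σ • (y - y 2 • (EuclideanSpace.single (2 : Fin 3) (1 : ℝ))) + y 2 • (EuclideanSpace.single (2 : Fin 3) (1 : ℝ)))) = V ∘ M :=
    funext fun y => by rw [comp_apply, hMx]
  have hgun : (fun y : (EuclideanSpace ℝ (Fin 3)) => y - y 2 • (EuclideanSpace.single (2 : Fin 3) (1 : ℝ))) = L := funext fun y => (hLx y).symm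
  have hVd : DifferentiableAt ℝ V (M x) := (hV.differentiable (by simp)) _
  have hf : HasFDerivAt (V ∘ M) ((fderiv ℝ V (M x)).comp M) x :=
    hVd.hasFDerivAt.comp x M.hasFDerivAt
  have hg : HasFDerivAt (⇑L) L x := L.hasFDerivAt
  have key : fderiv ℝ (fun y : (EuclideanSpace ℝ (Fin 3)) => ⟪(V ∘ M) y, L y⟫_ℝ) x w =
      ⟪(V ∘ M) x, L w⟫_ℝ + ⟪(fderiv ℝ V (M x)).comp M w, L x⟫_ℝ := by
    rw [fderiv_inner_apply ℝ hf.differentiableAt hg.differentiableAt, hf.fderiv, hg.fderiv]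
  have hfun2 : (fun y : (EuclideanSpace ℝ (Fin 3)) => ⟪V (σ • (y - y 2 • (EuclideanSpace.single (2 : Fin 3) (1 : ℝ))) + y 2 • (EuclideanSpace.single (2 : Fin 3) (1 : ℝ))), y - y 2 • (EuclideanSpace.single (2 : Fin 3) (1 : ℝ))⟫_ℝ) =
      fun y : (EuclideanSpace ℝ (Fin 3)) => ⟪(V ∘ M) y, L y⟫_ℝ := by
    funext y
    rw [comp_apply, hMx, hLx]
  rw [hfun2, key, comp_apply, hMx, hLx, ContinuousLinearMap.comp_apply, hMx, hLx]

/-- For a horizontal basis direction `eᵢ` (`i = 0, 1`) the slice derivative is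
`Vᵢ(σ x_h + x₂ e₂) + σ ⟪DV(σ x_h + x₂ e₂) eᵢ, x_h⟫`. [folklore] -/
private theorem fderiv_lineIntegrand_slice_single {V : (EuclideanSpace ℝ (Fin 3)) → (EuclideanSpace ℝ (Fin 3))} (hV : ContDiff ℝ ∞ V) (σ : ℝ) (x : (EuclideanSpace ℝ (Fin 3)))
    {i : Fin 3} (hi : i = 0 ∨ i = 1) :
    fderiv ℝ (fun y : (EuclideanSpace ℝ (Fin 3)) =>
        ⟪V (σ • (y - y 2 • (EuclideanSpace.single (2 : Fin 3) (1 : ℝ))) + y 2 • (EuclideanSpace.single (2 : Fin 3) (1 : ℝ))), y - y 2 • (EuclideanSpace.single (2 : Fin 3) (1 : ℝ))⟫_ℝ) x (EuclideanSpace.single i (1 : ℝ)) =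
      V (σ • (x - x 2 • (EuclideanSpace.single (2 : Fin 3) (1 : ℝ))) + x 2 • (EuclideanSpace.single (2 : Fin 3) (1 : ℝ))) i +
        σ * ⟪fderiv ℝ V (σ • (x - x 2 • (EuclideanSpace.single (2 : Fin 3) (1 : ℝ))) + x 2 • (EuclideanSpace.single (2 : Fin 3) (1 : ℝ))) (EuclideanSpace.single i (1 : ℝ)), x - x 2 • (EuclideanSpace.single (2 : Fin 3) (1 : ℝ))⟫_ℝ := by
  rw [fderiv_lineIntegrand_slice hV σ x]
  have hi2 : (EuclideanSpace.single i (1 : ℝ) : (EuclideanSpace ℝ (Fin 3))) 2 = 0 := by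
    rcases hi with rfl | rfl <;> simp
  rw [hi2, zero_smul, sub_zero, add_zero, map_smul, real_inner_smul_left,
    EuclideanSpace.inner_single_right]
  simp

/-- The symmetry `∂₀V₁ = ∂₁V₀` (vanishing vertical vorticity) turns `⟪DV eᵢ, x_h⟫` into the
`i`-th coordinate of the directional derivative along the horizontal part: `⟪DV eᵢ, x_h⟫ = (DV x_h)ᵢ`
for `i = 0, 1`. [folklore] -/
private theorem inner_apply_single_horiz (D : (EuclideanSpace ℝ (Fin 3)) →L[ℝ] (EuclideanSpace ℝ (Fin 3))) (hsym : D (EuclideanSpace.single (0 : Fin 3) (1 : ℝ)) 1 = D (EuclideanSpace.single (1 : Fin 3) (1 : ℝ)) 0) (x : (EuclideanSpace ℝ (Fin 3)))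
    {i : Fin 3} (hi : i = 0 ∨ i = 1) :
    ⟪D (EuclideanSpace.single i (1 : ℝ)), x - x 2 • (EuclideanSpace.single (2 : Fin 3) (1 : ℝ))⟫_ℝ = D (x - x 2 • (EuclideanSpace.single (2 : Fin 3) (1 : ℝ))) i := by
  rw [sub_smul_single_two_eq]
  rcases hi with rfl | rfl
  · simp [PiLp.inner_apply, Fin.sum_univ_three, map_add, map_smul, hsym]
  · simp [PiLp.inner_apply, Fin.sum_univ_three, map_add, map_smul, ← hsym]

/-- Vanishing vertical vorticity is the symmetry `∂₀V₁ = ∂₁V₀` of the Jacobian. [folklore] -/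
private theorem fderiv_apply_symm_of_curl_two_eq_zero {V : (EuclideanSpace ℝ (Fin 3)) → (EuclideanSpace ℝ (Fin 3))} {y : (EuclideanSpace ℝ (Fin 3))} (h : curl V y 2 = 0) :
    fderiv ℝ V y (EuclideanSpace.single (0 : Fin 3) (1 : ℝ)) 1 = fderiv ℝ V y (EuclideanSpace.single (1 : Fin 3) (1 : ℝ)) 0 := by
  have : curl V y 2 = fderiv ℝ V y (EuclideanSpace.single (0 : Fin 3) (1 : ℝ)) 1 - fderiv ℝ V y (EuclideanSpace.single (1 : Fin 3) (1 : ℝ)) 0 := by simp [curl]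
  rw [h] at this
  linarith


/-! ### The horizontal gradient of the line potential is the horizontal part of the field -/

/-- **Poincaré lemma in horizontal planes, with the height as a parameter.** If the vertical
vorticity of the smooth field `V` vanishes, `(curl V)₂ ≡ 0`, then the horizontal line potential
`φ(x) = ∫₀¹ ⟪V(σ x_h + x₂ e₂), x_h⟫ dσ` satisfies `∂ᵢφ = Vᵢ` for the horizontal directions
`i = 0, 1` (the integrand of `∂ᵢφ` is `d/dσ [σ Vᵢ(σ x_h + x₂ e₂)]` by the symmetry
`∂₀V₁ = ∂₁V₀`; fundamental theorem of calculus). [cite: Spivak1965, Thm 4-11 (Poincaré Lemma, formula for I on 1-forms)] -/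
theorem fderiv_linePotential_single {V : (EuclideanSpace ℝ (Fin 3)) → (EuclideanSpace ℝ (Fin 3))} (hV : ContDiff ℝ ∞ V)
    (hcurl : ∀ y, curl V y 2 = 0) (x : (EuclideanSpace ℝ (Fin 3))) {i : Fin 3} (hi : i = 0 ∨ i = 1) :
    fderiv ℝ (fun x : (EuclideanSpace ℝ (Fin 3)) =>
      ∫ σ in (0 : ℝ)..1, ⟪V (σ • (x - x 2 • (EuclideanSpace.single (2 : Fin 3) (1 : ℝ))) + x 2 • (EuclideanSpace.single (2 : Fin 3) (1 : ℝ))), x - x 2 • (EuclideanSpace.single (2 : Fin 3) (1 : ℝ))⟫_ℝ) x (EuclideanSpace.single i (1 : ℝ)) =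
      V x i := by
  rw [fderiv_linePotential_apply hV]
  set xh : (EuclideanSpace ℝ (Fin 3)) := x - x 2 • (EuclideanSpace.single (2 : Fin 3) (1 : ℝ)) with hxh
  set c : (EuclideanSpace ℝ (Fin 3)) := x 2 • (EuclideanSpace.single (2 : Fin 3) (1 : ℝ)) with hc
  have hpath : ∀ σ : ℝ, HasDerivAt (fun σ : ℝ => σ • xh + c) xh σ := fun σ => by
    simpa using ((hasDerivAt_id σ).smul_const xh).add_const c
  have hVd : ∀ z, HasFDerivAt V (fderiv ℝ V z) z := fun z =>
    ((hV.differentiable (by simp)) z).hasFDerivAt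
  have hcomp : ∀ σ : ℝ, HasDerivAt (fun σ : ℝ => V (σ • xh + c) i)
      (fderiv ℝ V (σ • xh + c) xh i) σ := by
    intro σ
    have h1 : HasDerivAt (fun σ : ℝ => V (σ • xh + c)) (fderiv ℝ V (σ • xh + c) xh) σ :=
      (hVd _).comp_hasDerivAt σ (hpath σ)
    exact (EuclideanSpace.proj i : (EuclideanSpace ℝ (Fin 3)) →L[ℝ] ℝ).hasFDerivAt.comp_hasDerivAt σ h1
  have hprod : ∀ σ : ℝ, HasDerivAt (fun σ : ℝ => σ * V (σ • xh + c) i)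
      (1 * V (σ • xh + c) i + σ * fderiv ℝ V (σ • xh + c) xh i) σ := fun σ =>
    (hasDerivAt_id' σ).mul (hcomp σ)
  have hint_eq : EqOn
      (fun σ : ℝ => fderiv ℝ (fun y : (EuclideanSpace ℝ (Fin 3)) =>
        ⟪V (σ • (y - y 2 • (EuclideanSpace.single (2 : Fin 3) (1 : ℝ))) + y 2 • (EuclideanSpace.single (2 : Fin 3) (1 : ℝ))), y - y 2 • (EuclideanSpace.single (2 : Fin 3) (1 : ℝ))⟫_ℝ) x (EuclideanSpace.single i (1 : ℝ)))
      (fun σ : ℝ => 1 * V (σ • xh + c) i + σ * fderiv ℝ V (σ • xh + c) xh i) (uIcc (0 : ℝ) 1) := by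
    intro σ _
    simp only
    rw [fderiv_lineIntegrand_slice_single hV σ x hi,
      inner_apply_single_horiz _ (fderiv_apply_symm_of_curl_two_eq_zero (hcurl _)) x hi, one_mul]
  rw [intervalIntegral.integral_congr hint_eq,
    intervalIntegral.integral_eq_sub_of_hasDerivAt (fun σ _ => hprod σ) ?_]
  · simp [hxh, hc]
  · apply Continuous.intervalIntegrable
    have hVc : Continuous V := hV.continuous
    have hDc : Continuous (fderiv ℝ V) := hV.continuous_fderiv (by simp)
    have hp : Continuous (fun σ : ℝ => σ • xh + c) :=
      (continuous_id.smul continuous_const).add continuous_const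
    have hπ : Continuous (fun v : (EuclideanSpace ℝ (Fin 3)) => v i) := (EuclideanSpace.proj i : (EuclideanSpace ℝ (Fin 3)) →L[ℝ] ℝ).continuous
    exact (continuous_const.mul (hπ.comp (hVc.comp hp))).add
      (continuous_id.mul (hπ.comp ((hDc.comp hp).clm_apply continuous_const)))


/-! ### Second derivatives of the potential and the stream function `ψ = V₂ − ∂₂φ` -/

/-- `∂_w (Vᵢ) = (DV w)ᵢ` (the coordinate forms are continuous linear). [cite: Spivak1965, Thm 2-3 (3)] -/
theorem fderiv_apply_coord {V : (EuclideanSpace ℝ (Fin 3)) → (EuclideanSpace ℝ (Fin 3))} (hV : ContDiff ℝ ∞ V) (x w : (EuclideanSpace ℝ (Fin 3))) (i : Fin 3) :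
    fderiv ℝ (fun y => V y i) x w = fderiv ℝ V x w i := by
  have hd : DifferentiableAt ℝ V x := (hV.differentiable (by simp)) x
  have e1 : (fun y => V y i) = (EuclideanSpace.proj i : (EuclideanSpace ℝ (Fin 3)) →L[ℝ] ℝ) ∘ V := by
    funext y; rfl
  rw [e1, fderiv_comp x (EuclideanSpace.proj i : (EuclideanSpace ℝ (Fin 3)) →L[ℝ] ℝ).differentiableAt hd,
    ContinuousLinearMap.fderiv]
  rfl

/-- `(∂ᵢ V)ᵢ`-type smoothness: `y ↦ V y i` is smooth. [folklore] -/
private theorem contDiff_apply_coord {V : (EuclideanSpace ℝ (Fin 3)) → (EuclideanSpace ℝ (Fin 3))} (hV : ContDiff ℝ ∞ V) (i : Fin 3) :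
    ContDiff ℝ ∞ fun y => V y i :=
  (EuclideanSpace.proj i : (EuclideanSpace ℝ (Fin 3)) →L[ℝ] ℝ).contDiff.comp hV

/-- `y ↦ ∂_u φ (y)` is smooth for smooth `φ`. [folklore] -/
private theorem contDiff_fderiv_apply_const {φ : (EuclideanSpace ℝ (Fin 3)) → ℝ} (hφ : ContDiff ℝ ∞ φ) (u : (EuclideanSpace ℝ (Fin 3))) :
    ContDiff ℝ ∞ fun y => fderiv ℝ φ y u :=
  (hφ.fderiv_right (m := ∞) le_rfl).clm_apply contDiff_const

/-- The derivative of the stream function `ψ = V₂ − ∂₂φ` of the line potential: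
`∂_w ψ = (DV w)₂ − ∂₂(∂_w φ)`. [cite: Spivak1965, Thm 2-3 (3) and Thm 2-5] -/
theorem fderiv_stream_apply {V : (EuclideanSpace ℝ (Fin 3)) → (EuclideanSpace ℝ (Fin 3))} (hV : ContDiff ℝ ∞ V) {φ : (EuclideanSpace ℝ (Fin 3)) → ℝ} (hφ : ContDiff ℝ ∞ φ)
    (x w : (EuclideanSpace ℝ (Fin 3))) :
    fderiv ℝ (fun y => V y 2 - fderiv ℝ φ y (EuclideanSpace.single (2 : Fin 3) (1 : ℝ))) x w =
      fderiv ℝ V x w 2 - fderiv ℝ (fun y => fderiv ℝ φ y w) x (EuclideanSpace.single (2 : Fin 3) (1 : ℝ)) := by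
  have hdV2 : DifferentiableAt ℝ (fun y => V y 2) x :=
    ((contDiff_apply_coord hV 2).differentiable (by simp)) x
  have hdφ2 : DifferentiableAt ℝ (fun y => fderiv ℝ φ y (EuclideanSpace.single (2 : Fin 3) (1 : ℝ))) x :=
    ((contDiff_fderiv_apply_const hφ (EuclideanSpace.single (2 : Fin 3) (1 : ℝ))).differentiable (by simp)) x
  rw [fderiv_fun_sub hdV2 hdφ2, _root_.sub_apply, fderiv_apply_coord hV,
    SerrinBoundedHolder.fderiv_fderiv_apply_comm (hφ.of_le (by norm_cast)) x (EuclideanSpace.single (2 : Fin 3) (1 : ℝ)) w]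

/-- **The vorticity of a field with vanishing vertical vorticity is `∇ψ × e₂`**, `ψ = V₂ − ∂₂φ`
with `φ` the horizontal line potential: in coordinates `(curl V)₀ = ∂₁ψ`, `(curl V)₁ = −∂₀ψ`,
`(curl V)₂ = 0` (since `∂₀φ = V₀`, `∂₁φ = V₁` and second derivatives commute). [cite: MajdaBertozziCUP2002, §1.1 (vector identities)] -/
theorem curl_apply_eq_fderiv_stream {V : (EuclideanSpace ℝ (Fin 3)) → (EuclideanSpace ℝ (Fin 3))} (hV : ContDiff ℝ ∞ V)
    (hcurl : ∀ y, curl V y 2 = 0) {φ : (EuclideanSpace ℝ (Fin 3)) → ℝ}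
    (hφ : φ = fun x : (EuclideanSpace ℝ (Fin 3)) =>
      ∫ σ in (0 : ℝ)..1, ⟪V (σ • (x - x 2 • (EuclideanSpace.single (2 : Fin 3) (1 : ℝ))) + x 2 • (EuclideanSpace.single (2 : Fin 3) (1 : ℝ))), x - x 2 • (EuclideanSpace.single (2 : Fin 3) (1 : ℝ))⟫_ℝ)
    (x : (EuclideanSpace ℝ (Fin 3))) :
    curl V x 0 = fderiv ℝ (fun y => V y 2 - fderiv ℝ φ y (EuclideanSpace.single (2 : Fin 3) (1 : ℝ))) x (EuclideanSpace.single (1 : Fin 3) (1 : ℝ)) ∧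
      curl V x 1 = -fderiv ℝ (fun y => V y 2 - fderiv ℝ φ y (EuclideanSpace.single (2 : Fin 3) (1 : ℝ))) x (EuclideanSpace.single (0 : Fin 3) (1 : ℝ)) ∧
      curl V x 2 = 0 := by
  have hφs : ContDiff ℝ ∞ φ := by rw [hφ]; exact contDiff_linePotential hV
  have h0 : (fun y => fderiv ℝ φ y (EuclideanSpace.single (0 : Fin 3) (1 : ℝ))) = fun y => V y 0 :=
    funext fun y => by rw [hφ]; exact fderiv_linePotential_single hV hcurl y (Or.inl rfl)
  have h1 : (fun y => fderiv ℝ φ y (EuclideanSpace.single (1 : Fin 3) (1 : ℝ))) = fun y => V y 1 :=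
    funext fun y => by rw [hφ]; exact fderiv_linePotential_single hV hcurl y (Or.inr rfl)
  have hc : curl V x = WithLp.toLp 2 ![fderiv ℝ V x (EuclideanSpace.single (1 : Fin 3) (1 : ℝ)) 2 - fderiv ℝ V x (EuclideanSpace.single (2 : Fin 3) (1 : ℝ)) 1,
      fderiv ℝ V x (EuclideanSpace.single (2 : Fin 3) (1 : ℝ)) 0 - fderiv ℝ V x (EuclideanSpace.single (0 : Fin 3) (1 : ℝ)) 2, fderiv ℝ V x (EuclideanSpace.single (0 : Fin 3) (1 : ℝ)) 1 - fderiv ℝ V x (EuclideanSpace.single (1 : Fin 3) (1 : ℝ)) 0] := rfl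
  refine ⟨?_, ?_, hcurl x⟩
  · rw [fderiv_stream_apply hV hφs, h1, fderiv_apply_coord hV, hc]
    simp
  · rw [fderiv_stream_apply hV hφs, h0, fderiv_apply_coord hV, hc]
    simp

/-- **The divergence in potential form**: `div V = Δφ + ∂₂ψ` for the line potential `φ` and
`ψ = V₂ − ∂₂φ` (`div V = ∂₀∂₀φ + ∂₁∂₁φ + ∂₂(∂₂φ + ψ)`). In particular a divergence-free field with
vanishing vertical vorticity satisfies `Δφ + ∂₂ψ = 0`. [cite: MajdaBertozziCUP2002, §1.1 (vector identities)] -/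
theorem divergence_eq_laplacian_add_fderiv_stream {V : (EuclideanSpace ℝ (Fin 3)) → (EuclideanSpace ℝ (Fin 3))} (hV : ContDiff ℝ ∞ V)
    (hcurl : ∀ y, curl V y 2 = 0) {φ : (EuclideanSpace ℝ (Fin 3)) → ℝ}
    (hφ : φ = fun x : (EuclideanSpace ℝ (Fin 3)) =>
      ∫ σ in (0 : ℝ)..1, ⟪V (σ • (x - x 2 • (EuclideanSpace.single (2 : Fin 3) (1 : ℝ))) + x 2 • (EuclideanSpace.single (2 : Fin 3) (1 : ℝ))), x - x 2 • (EuclideanSpace.single (2 : Fin 3) (1 : ℝ))⟫_ℝ)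
    (x : (EuclideanSpace ℝ (Fin 3))) :
    VectorCalculus.divergence V x =
      (Δ φ) x + fderiv ℝ (fun y => V y 2 - fderiv ℝ φ y (EuclideanSpace.single (2 : Fin 3) (1 : ℝ))) x (EuclideanSpace.single (2 : Fin 3) (1 : ℝ)) := by
  have hφs : ContDiff ℝ ∞ φ := by rw [hφ]; exact contDiff_linePotential hV
  have h0 : (fun y => fderiv ℝ φ y (EuclideanSpace.single (0 : Fin 3) (1 : ℝ))) = fun y => V y 0 :=
    funext fun y => by rw [hφ]; exact fderiv_linePotential_single hV hcurl y (Or.inl rfl)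
  have h1 : (fun y => fderiv ℝ φ y (EuclideanSpace.single (1 : Fin 3) (1 : ℝ))) = fun y => V y 1 :=
    funext fun y => by rw [hφ]; exact fderiv_linePotential_single hV hcurl y (Or.inr rfl)
  rw [VectorCalculus.divergence, trace_eq_sum_coord,
    laplacian_eq_sum_fderiv_fderiv (EuclideanSpace.basisFun (Fin 3) ℝ) (hφs.of_le (by norm_cast)) x,
    fderiv_stream_apply hV hφs]
  simp only [EuclideanSpace.basisFun_apply, Fin.sum_univ_three]
  rw [h0, h1, fderiv_apply_coord hV, fderiv_apply_coord hV]
  ring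


/-! ### Packaged form: `V = ∇φ + ψ e₂`, `curl V = ∇ψ × e₂`, `div V = Δφ + ∂₂ψ` -/

/-- **Potentials of a field with vanishing vertical vorticity.** A smooth field `V` on `(EuclideanSpace ℝ (Fin 3))` with
`(curl V)₂ ≡ 0` is a gradient plus a vertical field, `V = ∇φ + ψ e₂`, with `φ, ψ` smooth,
`φ` vanishing on the vertical axis; then `curl V = ∇ψ × e₂` (the vortex lines are the level curves
of `ψ` in the horizontal planes) and `div V = Δφ + ∂₂ψ`. (This is the purely POLOIDAL case of the
poloidal–toroidal decomposition with respect to `e₂`; `φ` is the horizontal line potential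
`∫₀¹ ⟪V(σ x_h + x₂ e₂), x_h⟫ dσ` and `ψ = V₂ − ∂₂φ`.) [cite: Spivak1965, Thm 4-11 and Problem 4-19 (c)] -/
theorem exists_potential_add_vertical {V : (EuclideanSpace ℝ (Fin 3)) → (EuclideanSpace ℝ (Fin 3))} (hV : ContDiff ℝ ∞ V)
    (hcurl : ∀ y, curl V y 2 = 0) :
    ∃ φ ψ : (EuclideanSpace ℝ (Fin 3)) → ℝ, ContDiff ℝ ∞ φ ∧ ContDiff ℝ ∞ ψ ∧
      (∀ x, fderiv ℝ φ x (EuclideanSpace.single (0 : Fin 3) (1 : ℝ)) = V x 0) ∧ (∀ x, fderiv ℝ φ x (EuclideanSpace.single (1 : Fin 3) (1 : ℝ)) = V x 1) ∧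
      (∀ x, V x 2 = fderiv ℝ φ x (EuclideanSpace.single (2 : Fin 3) (1 : ℝ)) + ψ x) ∧
      (∀ x, V x = gradient φ x + ψ x • (EuclideanSpace.single (2 : Fin 3) (1 : ℝ))) ∧
      (∀ x, curl V x 0 = fderiv ℝ ψ x (EuclideanSpace.single (1 : Fin 3) (1 : ℝ)) ∧ curl V x 1 = -fderiv ℝ ψ x (EuclideanSpace.single (0 : Fin 3) (1 : ℝ)) ∧ curl V x 2 = 0) ∧
      (∀ x, curl V x = cross (gradient ψ x) (EuclideanSpace.single (2 : Fin 3) (1 : ℝ))) ∧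
      (∀ x, VectorCalculus.divergence V x = (Δ φ) x + fderiv ℝ ψ x (EuclideanSpace.single (2 : Fin 3) (1 : ℝ))) ∧
      (∀ c : ℝ, φ (c • (EuclideanSpace.single (2 : Fin 3) (1 : ℝ))) = 0) := by
  set φ : (EuclideanSpace ℝ (Fin 3)) → ℝ := fun x : (EuclideanSpace ℝ (Fin 3)) =>
    ∫ σ in (0 : ℝ)..1, ⟪V (σ • (x - x 2 • (EuclideanSpace.single (2 : Fin 3) (1 : ℝ))) + x 2 • (EuclideanSpace.single (2 : Fin 3) (1 : ℝ))), x - x 2 • (EuclideanSpace.single (2 : Fin 3) (1 : ℝ))⟫_ℝ with hφ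
  set ψ : (EuclideanSpace ℝ (Fin 3)) → ℝ := fun y => V y 2 - fderiv ℝ φ y (EuclideanSpace.single (2 : Fin 3) (1 : ℝ)) with hψ
  have hφs : ContDiff ℝ ∞ φ := contDiff_linePotential hV
  have hψs : ContDiff ℝ ∞ ψ := (contDiff_apply_coord hV 2).sub (contDiff_fderiv_apply_const hφs (EuclideanSpace.single (2 : Fin 3) (1 : ℝ)))
  have h0 : ∀ x, fderiv ℝ φ x (EuclideanSpace.single (0 : Fin 3) (1 : ℝ)) = V x 0 := fun x =>
    fderiv_linePotential_single hV hcurl x (Or.inl rfl)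
  have h1 : ∀ x, fderiv ℝ φ x (EuclideanSpace.single (1 : Fin 3) (1 : ℝ)) = V x 1 := fun x =>
    fderiv_linePotential_single hV hcurl x (Or.inr rfl)
  have h2 : ∀ x, V x 2 = fderiv ℝ φ x (EuclideanSpace.single (2 : Fin 3) (1 : ℝ)) + ψ x := fun x => by
    simp only [hψ]; ring
  have hcomp : ∀ x, curl V x 0 = fderiv ℝ ψ x (EuclideanSpace.single (1 : Fin 3) (1 : ℝ)) ∧ curl V x 1 = -fderiv ℝ ψ x (EuclideanSpace.single (0 : Fin 3) (1 : ℝ)) ∧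
      curl V x 2 = 0 := fun x => curl_apply_eq_fderiv_stream hV hcurl hφ x
  -- coordinates of gradients
  have hgrad : ∀ (f : (EuclideanSpace ℝ (Fin 3)) → ℝ) (x : (EuclideanSpace ℝ (Fin 3))) (i : Fin 3), gradient f x i = fderiv ℝ f x (EuclideanSpace.single i (1 : ℝ)) := by
    intro f x i
    have e : gradient f x i = ⟪gradient f x, EuclideanSpace.single i (1 : ℝ)⟫_ℝ := by
      rw [EuclideanSpace.inner_single_right]; simp
    rw [e, gradient, InnerProductSpace.toDual_symm_apply]
  refine ⟨φ, ψ, hφs, hψs, h0, h1, h2, fun x => ?_, hcomp, fun x => ?_,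
    fun x => divergence_eq_laplacian_add_fderiv_stream hV hcurl hφ x, fun c => ?_⟩
  · ext i
    fin_cases i
    · simp [hgrad, h0]
    · simp [hgrad, h1]
    · simp [hgrad, h2 x]
  · obtain ⟨hc0, hc1, hc2⟩ := hcomp x
    ext i
    fin_cases i
    · simp [cross, cross_apply, hgrad, hc0]
    · simp [cross, cross_apply, hgrad, hc1]
    · simp [cross, cross_apply, hc2]
  · simp [hφ]

end VerticalVorticityFree





end Literature.Analysis.FluidPDE

end
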